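import Summits.CriticalPhenomena.CardyFormulaZ2.Theorems.CardyComplexConeEdgePrecompactUFRSAnnulusCrossings
import Literature.Probability.LatticeModels.MedialCycleTurning
import Literature.Probability.Percolation.TriCrossingSandwich

/-!
# Strands ⇒ arms, I: the perturbed pieces of an orbit stretch (mesh `1`)
(line `qkz-strip-boundary-arm` of crux `CardyComplexCone.EdgePrecompact`, stmt-CriticalPhenomena-11387;
planar bookkeeping for the registered sub-goal `ufrs_strands_zdDomArms`, item 5 of the corrected
road map in `…EdgePrecompactUFRSAnnulusCrossings.lean`)

An orbit stretch `O q [0, n]` of Smirnov's successor map `nextCorner β` is drawn, at mesh `1`, as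
the perturbed polyline of `MedialCycleTurning.lean`: vertices `pieceVert β q j` (`sPt`, `tPt` of
the successive corners), pieces `[pieceVert β q j, pieceVert β q (j+1)]` (dart pieces for even `j`,
connectors for odd `j`). This file records what the sector argument of `…UFRSStrandsArms.lean`
needs about these pieces:

* sharp distances: every piece has diameter `< 1/2`; the shifted points of a corner are within
  `1/2` of its vertex AND of the centre of its face (`faceCenter (cFace p) = v + I^k (1+i)/2`);
  a piece `j` is within `3/2` of the vertices / face centres of the corners `j/2 - 1 … j/2 + 1`;
* two pieces of two stretches of ONE configuration meet only if the stretches share a corner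
  (`pieces_meet`, from the intersection table `std_DD … std_VF`).

What the pieces miss (lattice points, face centres, half-diagonals, open edges, dual steps across
closed edges) is in the sequel `…UFRSStrandsArmsCrossing.lean`.

References: S. Smirnov, C. R. Acad. Sci. Paris 333 (2001), §2; M. Aizenman, A. Burchard, Duke
Math. J. 99 (1999), Appendix A (perturbed crossing segments).
-/

namespace Summit.CriticalPhenomena.CardyFormulaZ2.Cruxes.EdgePrecompact.QkzStripBoundaryArm

open MeasureTheory Filter Set Metric Complex
open scoped Topology BigOperators Pointwise
open Literature.Probability.LatticeModels Literature.Probability.Percolation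
open Literature.Probability.RandomPlanarGeometry (DobrushinDomain)
open Summit.CriticalPhenomena.CardyFormulaZ2.Theses.CardyComplexCone

noncomputable section

/-! ## Sharp distances -/

/-- Rotation by a power of `I` preserves the norm. -/
theorem norm_I_pow_mul (k : ℕ) (x : ℂ) : ‖I ^ k * x‖ = ‖x‖ := by
  rw [norm_mul, norm_pow, norm_I, one_pow, one_mul]

/-- A complex number with `re² + im² < 1/4` has norm `< 1/2`. -/
private theorem norm_lt_half_W3A {x : ℂ} (h : x.re * x.re + x.im * x.im < 1 / 4) : ‖x‖ < 1 / 2 := by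
  have h2 : ‖x‖ ^ 2 < (1 / 2) ^ 2 := by rw [Complex.sq_norm, normSq_apply]; linarith
  exact (pow_lt_pow_iff_left₀ (norm_nonneg x) (by norm_num : (0 : ℝ) ≤ 1 / 2) two_ne_zero).1 h2

/-- The shifted source point of a corner is within `1/2` of its vertex. -/
theorem dist_sPt_vertex_lt (p : Site 2 × Fin 4) : dist (sPt p) (Site.toComplex p.1) < 1 / 2 := by
  rw [dist_eq_norm, sPt, add_sub_cancel_left, norm_I_pow_mul]
  exact norm_lt_half_W3A (by norm_num [dS])

/-- The shifted target point of a corner is within `1/2` of its vertex. -/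
theorem dist_tPt_vertex_lt (p : Site 2 × Fin 4) : dist (tPt p) (Site.toComplex p.1) < 1 / 2 := by
  rw [dist_eq_norm, tPt, add_sub_cancel_left, norm_I_pow_mul]
  exact norm_lt_half_W3A (by norm_num [dT])

/-- **The centre of the face of a coded corner**: `faceCenter (cFace (v, k)) = v + I^k (1 + i)/2`. -/
theorem faceCenter_cFace (p : Site 2 × Fin 4) :
    faceCenter (cFace p) = Site.toComplex p.1 + I ^ (p.2 : ℕ) * ((1 + I) / 2) := by
  obtain ⟨v, k⟩ := p
  fin_cases k <;>
    apply Complex.ext <;>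
    simp [faceCenter, cFace, faceAt, cornerOff, Site.toComplex, pow_succ] <;> ring

/-- The centre of the next face around the vertex: `faceCenter (faceAt v (k+1)) = v + I^k (-1 + i)/2`. -/
theorem faceCenter_faceAt_succ (v : Site 2) (k : Fin 4) :
    faceCenter (faceAt v (k + 1)) = Site.toComplex v + I ^ (k : ℕ) * ((-1 + I) / 2) := by
  have h := faceCenter_cFace (v, k + 1)
  rw [cFace] at h
  simp only at h
  rw [h, I_pow_fin_succ]
  ring_nf
  rw [I_sq]
  ring

/-- The shifted source point of a corner is within `1/2` of the centre of its face. -/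
theorem dist_sPt_faceCenter_lt (p : Site 2 × Fin 4) : dist (sPt p) (faceCenter (cFace p)) < 1 / 2 := by
  rw [dist_eq_norm, sPt, faceCenter_cFace, add_sub_add_left_eq_sub, ← mul_sub, norm_I_pow_mul]
  exact norm_lt_half_W3A (by norm_num [dS])

/-- The shifted target point of a corner is within `1/2` of the centre of its face. -/
theorem dist_tPt_faceCenter_lt (p : Site 2 × Fin 4) : dist (tPt p) (faceCenter (cFace p)) < 1 / 2 := by
  rw [dist_eq_norm, tPt, faceCenter_cFace, add_sub_add_left_eq_sub, ← mul_sub, norm_I_pow_mul]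
  exact norm_lt_half_W3A (by norm_num [dT])

/-- A face centre is within `3/4` of the lower-left corner indexing the face. -/
theorem dist_toComplex_faceCenter_lt (f : Site 2) : dist (Site.toComplex f) (faceCenter f) < 3 / 4 := by
  rw [dist_eq_norm, faceCenter, sub_add_cancel_left, norm_neg]
  have h2 : ‖(1 + I) / 2‖ ^ 2 < (3 / 4) ^ 2 := by rw [Complex.sq_norm, normSq_apply]; norm_num
  exact (pow_lt_pow_iff_left₀ (norm_nonneg _) (by norm_num) two_ne_zero).1 h2

/-- The face centre of a corner is within `3/4` of its vertex. -/
theorem dist_faceCenter_vertex_lt (p : Site 2 × Fin 4) : dist (faceCenter (cFace p)) (Site.toComplex p.1) < 3 / 4 := by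
  rw [dist_eq_norm, faceCenter_cFace, add_sub_cancel_left, norm_I_pow_mul]
  have h2 : ‖(1 + I) / 2‖ ^ 2 < (3 / 4) ^ 2 := by rw [Complex.sq_norm, normSq_apply]; norm_num
  exact (pow_lt_pow_iff_left₀ (norm_nonneg _) (by norm_num) two_ne_zero).1 h2

/-- Consecutive vertices of an orbit are within `1` (mesh `1`). -/
theorem dist_vertex_succ_le (β : BondConfig (Site 2)) (q : Site 2 × Fin 4) (t : ℕ) :
    dist (Site.toComplex (cornerOrbit β q (t + 1)).1) (Site.toComplex (cornerOrbit β q t).1) ≤ 1 := by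
  simpa [meshPoint] using dist_meshPoint_cornerOrbit_succ_le β q 1 t

/-- Consecutive face centres of an orbit are within `1` (mesh `1`). -/
theorem dist_faceCenter_succ_le (β : BondConfig (Site 2)) (q : Site 2 × Fin 4) (t : ℕ) :
    dist (faceCenter (cFace (cornerOrbit β q (t + 1)))) (faceCenter (cFace (cornerOrbit β q t))) ≤ 1 := by
  have h := dist_meshPoint_cFace_cornerOrbit_succ_le β q 1 t
  rw [dist_eq_norm] at h ⊢
  rw [faceCenter, faceCenter, add_sub_add_right_eq_sub]
  simpa [meshPoint] using h

/-- The crossing segment of a corner (from the centre of its face to the centre of the next face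
around its vertex) has length `1`. -/
theorem dist_faceCenter_cross (p : Site 2 × Fin 4) :
    dist (faceCenter (cFace p)) (faceCenter (faceAt p.1 (p.2 + 1))) = 1 := by
  rw [dist_eq_norm, faceCenter_cFace, faceCenter_faceAt_succ, add_sub_add_left_eq_sub, ← mul_sub, norm_I_pow_mul,
    show (1 + I) / 2 - (-1 + I) / 2 = 1 by ring, norm_one]

/-! ## Pieces of an orbit: diameters and nearby corners -/

/-- The vertices of the perturbed polyline: `pieceVert β q j` is within `1/2` of the vertex of the
corner `O q (j/2)`. -/
theorem dist_pieceVert_vertex_lt (β : BondConfig (Site 2)) (q : Site 2 × Fin 4) (j : ℕ) :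
    dist (pieceVert β q j) (Site.toComplex (cornerOrbit β q (j / 2)).1) < 1 / 2 := by
  unfold pieceVert
  split_ifs
  · exact dist_sPt_vertex_lt _
  · exact dist_tPt_vertex_lt _

/-- `pieceVert β q j` is within `1/2` of the face centre of the corner `O q (j/2)`. -/
theorem dist_pieceVert_faceCenter_lt (β : BondConfig (Site 2)) (q : Site 2 × Fin 4) (j : ℕ) :
    dist (pieceVert β q j) (faceCenter (cFace (cornerOrbit β q (j / 2)))) < 1 / 2 := by
  unfold pieceVert
  split_ifs
  · exact dist_sPt_faceCenter_lt _
  · exact dist_tPt_faceCenter_lt _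

/-- **Every piece has diameter `< 1/2`** (dart pieces have length `√8/8`, connectors `1/4`). -/
theorem piece_diam_lt (β : BondConfig (Site 2)) (q : Site 2 × Fin 4) (j : ℕ) {z w : ℂ}
    (hz : z ∈ segment ℝ (pieceVert β q j) (pieceVert β q (j + 1)))
    (hw : w ∈ segment ℝ (pieceVert β q j) (pieceVert β q (j + 1))) : dist z w < 1 / 2 := by
  refine (dist_le_dist_of_mem_segment hz hw).trans_lt ?_
  obtain ⟨m, rfl | rfl⟩ := Nat.even_or_odd' j
  · rw [pieceVert_even, pieceVert_odd, dist_eq_norm, sPt, tPt, add_sub_add_left_eq_sub, ← mul_sub, norm_I_pow_mul]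
    exact norm_lt_half_W3A (by norm_num [dS, dT])
  · rw [show 2 * m + 1 + 1 = 2 * m + 2 by ring, pieceVert_odd, pieceVert_odd_succ, dist_eq_norm]
    by_cases hc : cTgt (cornerOrbit β q m) ∈ β
    · rw [sPt_nextCorner_of_mem hc, tPt, add_sub_add_left_eq_sub, ← mul_sub, norm_I_pow_mul]
      exact norm_lt_half_W3A (by norm_num [fE, dT])
    · rw [sPt_nextCorner_of_not_mem hc, tPt, add_sub_add_left_eq_sub, ← mul_sub, norm_I_pow_mul]
      exact norm_lt_half_W3A (by norm_num [vE, dT])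

/-- **A piece is within `3/2` of the neighbouring corners** (abstract form): if `g t` is within
`1/2` of `sPt (O q t)` and of `tPt (O q t)` and consecutive `g t` are within `1`, then the piece
`j` lies within `3/2` of `g i` for every `i` with `j/2 - 1 ≤ i ≤ j/2 + 1` (written without
subtraction). -/
theorem piece_near_of (β : BondConfig (Site 2)) (q : Site 2 × Fin 4) (g : ℕ → ℂ)
    (hg : ∀ t, dist (g (t + 1)) (g t) ≤ 1) (hv : ∀ j, dist (pieceVert β q j) (g (j / 2)) < 1 / 2)
    {j i : ℕ} (h1 : 2 * i ≤ j + 2) (h2 : j ≤ 2 * i + 2) {z : ℂ}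
    (hz : z ∈ segment ℝ (pieceVert β q j) (pieceVert β q (j + 1))) : dist z (g i) < 3 / 2 := by
  have hnear : ∀ a, (a = i ∨ a = i + 1 ∨ a + 1 = i) → dist (g a) (g i) ≤ 1 := by
    rintro a (rfl | rfl | rfl)
    · simp
    · exact hg i
    · rw [dist_comm]; exact hg a
  have hend : ∀ a, (a = i ∨ a = i + 1 ∨ a + 1 = i) → ∀ jj, jj / 2 = a → pieceVert β q jj ∈ ball (g i) (3 / 2) := by
    intro a ha jj hjj
    rw [mem_ball]
    have := hv jj
    rw [hjj] at this
    linarith [dist_triangle (pieceVert β q jj) (g a) (g i), hnear a ha]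
  have hA : pieceVert β q j ∈ ball (g i) (3 / 2) := hend (j / 2) (by omega) j rfl
  have hB : pieceVert β q (j + 1) ∈ ball (g i) (3 / 2) := hend ((j + 1) / 2) (by omega) (j + 1) rfl
  have := (convex_ball (g i) (3 / 2)).segment_subset hA hB hz
  rwa [mem_ball] at this

/-- A piece `j` is within `3/2` of the vertices of the corners `j/2 - 1 ≤ i ≤ j/2 + 1`. -/
theorem piece_near_vertex (β : BondConfig (Site 2)) (q : Site 2 × Fin 4) {j i : ℕ} (h1 : 2 * i ≤ j + 2)
    (h2 : j ≤ 2 * i + 2) {z : ℂ} (hz : z ∈ segment ℝ (pieceVert β q j) (pieceVert β q (j + 1))) :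
    dist z (Site.toComplex (cornerOrbit β q i).1) < 3 / 2 :=
  piece_near_of β q (fun t => Site.toComplex (cornerOrbit β q t).1) (dist_vertex_succ_le β q)
    (dist_pieceVert_vertex_lt β q) h1 h2 hz

/-- A piece `j` is within `3/2` of the face centres of the corners `j/2 - 1 ≤ i ≤ j/2 + 1`. -/
theorem piece_near_faceCenter (β : BondConfig (Site 2)) (q : Site 2 × Fin 4) {j i : ℕ} (h1 : 2 * i ≤ j + 2)
    (h2 : j ≤ 2 * i + 2) {z : ℂ} (hz : z ∈ segment ℝ (pieceVert β q j) (pieceVert β q (j + 1))) :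
    dist z (faceCenter (cFace (cornerOrbit β q i))) < 3 / 2 :=
  piece_near_of β q (fun t => faceCenter (cFace (cornerOrbit β q t))) (dist_faceCenter_succ_le β q)
    (dist_pieceVert_faceCenter_lt β q) h1 h2 hz

/-! ## Two pieces of one configuration meet only at a common corner -/

/-- **A dart piece and a connector meet only if** the connector leaves from or leads into the dart
(two arbitrary corners, one configuration; cf. `orb_eq_of_mem_dart_conn`). -/
theorem eq_or_next_eq_of_mem_dart_conn {β : BondConfig (Site 2)} {p p' : Site 2 × Fin 4} {z : ℂ}
    (hz : z ∈ segment ℝ (sPt p) (tPt p)) (hz' : z ∈ segment ℝ (tPt p') (sPt (nextCorner β p'))) :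
    p' = p ∨ nextCorner β p' = p := by
  by_cases hc : cTgt p' ∈ β
  · rw [nextCorner_of_mem hc] at hz' ⊢
    rcases eq_of_mem_dart_fconn hz hz' with h | h
    · exact Or.inl h
    · right
      rw [h]
      refine Prod.ext ?_ (fin4_add_one_add_three _)
      show p.1 + cornerUnit p.2 + cornerUnit (p.2 + 1 + 1) = p.1
      rw [fin4_add_one_add_one, cornerUnit_add_two]; abel
  · rw [nextCorner_of_not_mem hc] at hz' ⊢
    rcases eq_of_mem_dart_vconn hz hz' with h | h
    · exact Or.inl h
    · right
      rw [h]
      exact Prod.ext rfl (fin4_add_three_add_one _)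

/-- **Two connectors of one configuration meet only if they are the same** (two arbitrary
corners; cf. `orb_eq_of_mem_conn_conn`). -/
theorem eq_of_mem_conn_conn {β : BondConfig (Site 2)} {p p' : Site 2 × Fin 4} {z : ℂ}
    (hz : z ∈ segment ℝ (tPt p) (sPt (nextCorner β p))) (hz' : z ∈ segment ℝ (tPt p') (sPt (nextCorner β p'))) :
    p' = p := by
  by_cases hc : cTgt p ∈ β <;> by_cases hc' : cTgt p' ∈ β
  · rw [nextCorner_of_mem hc] at hz; rw [nextCorner_of_mem hc'] at hz'
    exact eq_of_mem_fconn_fconn hz hz'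
  · rw [nextCorner_of_mem hc] at hz; rw [nextCorner_of_not_mem hc'] at hz'
    rcases eq_of_mem_vconn_fconn hz' hz with h | h
    · rw [h] at hc; exact absurd hc hc'
    · rw [h, cTgt_of_vconn_fconn] at hc; exact absurd hc hc'
  · rw [nextCorner_of_not_mem hc] at hz; rw [nextCorner_of_mem hc'] at hz'
    rcases eq_of_mem_vconn_fconn hz hz' with h | h
    · rw [h] at hc'; exact absurd hc' hc
    · rw [h, cTgt_of_vconn_fconn] at hc'; exact absurd hc' hc
  · rw [nextCorner_of_not_mem hc] at hz; rw [nextCorner_of_not_mem hc'] at hz'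
    exact eq_of_mem_vconn_vconn hz hz'

/-- **Two pieces of two orbit stretches of one configuration meet only at a common corner**: if
the piece `j` of the orbit of `q₁` meets the piece `j'` of the orbit of `q₂`, then a corner
`O q₁ s`, `s ∈ {j/2, (j+1)/2}`, equals a corner `O q₂ t`, `t ∈ {j'/2, (j'+1)/2}`. -/
theorem pieces_meet {β : BondConfig (Site 2)} (q₁ q₂ : Site 2 × Fin 4) {j j' : ℕ} {z : ℂ}
    (hz : z ∈ segment ℝ (pieceVert β q₁ j) (pieceVert β q₁ (j + 1)))
    (hz' : z ∈ segment ℝ (pieceVert β q₂ j') (pieceVert β q₂ (j' + 1))) :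
    ∃ s t, (s = j / 2 ∨ s = (j + 1) / 2) ∧ (t = j' / 2 ∨ t = (j' + 1) / 2) ∧
      cornerOrbit β q₁ s = cornerOrbit β q₂ t := by
  obtain ⟨m, rfl | rfl⟩ := Nat.even_or_odd' j <;> obtain ⟨m', rfl | rfl⟩ := Nat.even_or_odd' j'
  · rw [pieceVert_even, pieceVert_odd] at hz hz'
    exact ⟨m, m', Or.inl (by omega), Or.inl (by omega), (eq_of_mem_dart_dart hz hz').symm⟩
  · rw [pieceVert_even, pieceVert_odd] at hz
    rw [pieceVert_odd, show 2 * m' + 1 + 1 = 2 * m' + 2 by ring, pieceVert_odd_succ] at hz'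
    rcases eq_or_next_eq_of_mem_dart_conn hz hz' with h | h
    · exact ⟨m, m', Or.inl (by omega), Or.inl (by omega), h.symm⟩
    · exact ⟨m, m' + 1, Or.inl (by omega), Or.inr (by omega), h.symm⟩
  · rw [pieceVert_odd, show 2 * m + 1 + 1 = 2 * m + 2 by ring, pieceVert_odd_succ] at hz
    rw [pieceVert_even, pieceVert_odd] at hz'
    rcases eq_or_next_eq_of_mem_dart_conn hz' hz with h | h
    · exact ⟨m, m', Or.inl (by omega), Or.inl (by omega), h⟩
    · exact ⟨m + 1, m', Or.inr (by omega), Or.inl (by omega), h⟩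
  · rw [pieceVert_odd, show 2 * m + 1 + 1 = 2 * m + 2 by ring, pieceVert_odd_succ] at hz
    rw [pieceVert_odd, show 2 * m' + 1 + 1 = 2 * m' + 2 by ring, pieceVert_odd_succ] at hz'
    exact ⟨m, m', Or.inl (by omega), Or.inl (by omega), (eq_of_mem_conn_conn hz hz').symm⟩

/-- **Pieces of corner-disjoint stretches of one configuration are disjoint** (registered
sub-goal `ufrs_piecesMeet` of stmt-CriticalPhenomena-11387, the planar input "disjoint perturbed
polylines" of item 5 of the UFRS road map): two pieces of the perturbed polylines of two orbits of
`nextCorner β` meet only at a common corner. -/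
theorem ufrs_piecesMeet : ∀ (β : BondConfig (Site 2)) (q₁ q₂ : Site 2 × Fin 4) (j j' : ℕ) (z : ℂ), z ∈ segment ℝ (pieceVert β q₁ j) (pieceVert β q₁ (j + 1)) → z ∈ segment ℝ (pieceVert β q₂ j') (pieceVert β q₂ (j' + 1)) → ∃ s t : ℕ, (s = j / 2 ∨ s = (j + 1) / 2) ∧ (t = j' / 2 ∨ t = (j' + 1) / 2) ∧ cornerOrbit β q₁ s = cornerOrbit β q₂ t :=
  fun _β q₁ q₂ _j _j' _z hz hz' => pieces_meet q₁ q₂ hz hz'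

end

end Summit.CriticalPhenomena.CardyFormulaZ2.Cruxes.EdgePrecompact.QkzStripBoundaryArm
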